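import Summits.BirchSwinnertonDyer.BirchSwinnertonDyer.Theses.UniversalToricDescent
import Summits.BirchSwinnertonDyer.BirchSwinnertonDyer.Theorems.UniversalToricDescentThinCombDefs
import Summits.BirchSwinnertonDyer.BirchSwinnertonDyer.Theorems.UniversalToricDescentAdditiveSplitIMCInclusionAtThreeStubFrame
import Summits.BirchSwinnertonDyer.BirchSwinnertonDyer.Theorems.UniversalToricDescentAdditiveSplitIMCInclusionAtThreeStubCharIdealPrincipal
import Summits.BirchSwinnertonDyer.BirchSwinnertonDyer.Theorems.UniversalToricDescentAdditiveSplitIMCInclusionAtThreeStubWeakRigidity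
import Summits.BirchSwinnertonDyer.BirchSwinnertonDyer.Theorems.UniversalToricDescentAdditiveSplitIMCInclusionAtThreeStubDescent
import Summits.BirchSwinnertonDyer.BirchSwinnertonDyer.Theorems.UniversalToricDescentThinCombLineValue
import Summits.BirchSwinnertonDyer.BirchSwinnertonDyer.Theorems.SignedBaseChangeAnticyclotomicEisensteinDivisibilityXGrTwoModuleFinite
import Literature.NumberTheory.EllipticCurves.TwoVariableSelmerDual
import Literature.NumberTheory.EllipticCurves.ZpExtensionSplitPrimeLineThroughPair
import Literature.NumberTheory.EllipticCurves.ToricTwoVariablePAdicLFunction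
import Summits.BirchSwinnertonDyer.BirchSwinnertonDyer.Theorems.UniversalToricDescentBDPFrameCrossPeriodRigidity
import Summits.BirchSwinnertonDyer.BirchSwinnertonDyer.Theorems.UniversalToricDescentThinCombContRigidity
import Summits.BirchSwinnertonDyer.BirchSwinnertonDyer.Theorems.UniversalToricDescentCharIdealVacuity
import Summits.BirchSwinnertonDyer.BirchSwinnertonDyer.Theorems.UniversalToricDescentAdditiveSplitIMCInclusionAtThreeStubTorsionTransfer
import HarnessLib

/-!
# Line `wedge_host` — crux `AdditiveSplitIMCInclusionAtThree` (stmt-BirchSwinnertonDyer-20395, THE WALL, UTD r201)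
# NODE of crux idea `wedge-square-host` (cruxidea-stmt-BirchSwinnertonDyer-20395-1 gen0, 2026-08-29): a CHILD of the
# registered line `thin_comb` v8.1 (sha16 de4907cf46678a2e) in which the wall stub `stub_combDivisibility`
# (K2⁺ ⊕ K4 ⊕ K3(iii)) is CUT along the new idea: the print-adjacent weak-reflection pair (K4 ⊕ K3(iii)) becomes
# `stub_reflectionPair`, and the beyond-print atom K2⁺ — INTEGRAL per-tooth divisibility `ThinCombDvdInt R₀ 3 G L₂` —
# becomes `stub_hostToothDivisibility`, the ONE stub the wedge-square host is meant to source. NOT registered (the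
# LEAD decides); `_of` concludes the crux BY NAME, kernel-checked, sorries only inside `stub_*`.

THE IDEA (card `Ideas/wedge-square-host.md`): realise the Rankin–Selberg motive `V_f ⊗ V_{θ_η}` (f = f_E, θ_η the CM
form of an anticyclotomic-type Hecke character η of K) NOT in `H²(Y × Y)` (Beilinson–Flach geometry, where every
3-power tower is driven by `U₃ ⊗ U₃` and dies of `r_B(π_{f,3}) = 0`, B-g50-3, or needs the 𝛉-dominant reciprocity law
through a family containing the supercuspidal `f`, K2(b-val)) but as the `A ⊗ B`-summand of the twisted exterior square
`∧² V_Π` of the ENDOSCOPIC cuspidal representation `Π = Π(σ_f ⊠ σ_θ)` of the quasi-split unitary group `GU(2,2)_{K/ℚ}`: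
`H⁴_et` of the `U(2,2)` Shimura FOURFOLD realises `∧²` (Kottwitz, cocharacter of signature (2,2)), the Euler-system
classes are pushforwards of ONE Siegel unit from the symmetric subgroup `H = G(U(1,1) × U(1,1))` (codimension 2:
`H¹_mot(Sh_H, ℚ(1)) → H⁵_mot(Sh_G, ℚ(3))`, the target group of Cauchi's norm-compatible classes
`_c𝒵 ∈ lim H⁵_et(Y_{GU(2,2)}, ℤ_p(3))`, arXiv:1711.10571), and at the SPLIT prime 3, `G(ℚ₃) ≅ GL₄ × GL₁`,
`Π₃ = Ind_{P_(2,2)}(π_{f,3} ⊗ π_{θ,3})`: the anticyclotomic tower is driven by the CENTRAL cocharacter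
`t ↦ diag(t,t,1,1)` of the `f`-block, whose parabolic is the Siegel `P_(2,2)` and whose Jacquet module
`r_{P_(2,2)}(Π₃) ∋ π_{f,3} ⊗ π_{θ,3}` keeps the supercuspidal `π_{f,3}` WHOLE (semi-ordinarity; the Euler-system
mirror of Wan's semi-ordinary Klingen trick used by SOED on the Eisenstein side). EVEN unitary rank ⇒ no `ε_K`-shift of
the endoscopic character (`n − a = 2`), so the classes live on the WALL component (contrast: `U(2,1)`, killed by
OddUnitaryParityShift, memo v24). Two uses: (U1, typed HERE) the host's Siegel-semi-ordinary FAMILY (CM block in its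
Hida family, `σ_f` constant) carries classes along the 𝔭-axis translates = the comb's TEETH, with a reciprocity law
provable inside a `P_(2,2)`-ordinary higher-Hida family that never stabilises `f` ⇒ source for
`stub_hostToothDivisibility` (and its family `p`-adic `L`-function is a second candidate source for K3a
`stub_toricExists`); (U2, NOT typable today — no `H¹_Iw`, Coleman map or Λ-adic `KS₀` in the tree) genuine
`Λ_ac`-adic classes over the anticyclotomic FIELD tower (from the `U(1)`-tori `det` of the two `U(1,1)` factors of
`H`), a non-Selmer rank-0 carrier on the wall line itself (B-g41-1-compliant) ⇒ the crux by ONE Λ-adic Kolyvagin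
argument, retiring the comb (`stub_reflectionPair`, `stub_noPseudoNull`, two-variable descent) altogether.

PIECE TAGS (D-0171): `stub_toricExists` UNDECIDED (K3a; NOT PRINT at 3 — typer-06 F050; leaf IDEA-NEEDED: host family
`L`-function / Hida 𝛉-measure at `p = 3`); `stub_reflectionPair` UNDECIDED, print-adjacent (K4 Nekovář duality +
`c`-transport, K3(iii) two-variable functional equation; leaf ATTACKABLE-conditional: lands modulo two typed Literature
facts); `stub_hostToothDivisibility` WEAKER than the two-variable IMC divisibility `G ∣ L₂`, UNDECIDED vs the crux (leaf
IDEA-NEEDED = this card; BARRIER-adjacent: beyond print at a supercuspidal 3 for EVERY known host); `stub_noPseudoNull`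
WEAKER (leaf ATTACKABLE: closed modulo `GaloisCohomology.poitouTate_shaRestricted_tateDual_natural_at`, Milne ADT I 4.10 (a),
`…ThinCombNoPseudoNullOfPoitouTate`). COSTUME: none — no stub mentions the BDP frame `L` or `XAc.charIdeal`; the crux's
objects enter only through the landed stubs `stub_frame`/`stub_descent`/`stub_torsionTransfer` and `ContRigidity`.
The split is logically faithful: `stub_combDivisibility ⇐ stub_reflectionPair ∧ stub_hostToothDivisibility` (the `∃ρ`
stays bundled with BOTH symmetries, as the lead requires — an un-pinned `∀ρ` form is false).
-/

set_option linter.dupNamespace false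
set_option autoImplicit false

noncomputable section

open NumberField IsDedekindDomain Field
open Literature.NumberTheory.EllipticCurves Literature.NumberTheory.GaloisRepresentations
open Summit.BirchSwinnertonDyer.BirchSwinnertonDyer.Theorems.UniversalToricDescentThinComb

namespace Summit.BirchSwinnertonDyer.BirchSwinnertonDyer.Cruxes.AdditiveSplitIMCInclusionAtThree.WedgeHost

/-- **K3a `stub_toricExists`** (VERBATIM the registered `ThinComb.stub_toricExists`, v8.1) — UNDECIDED; NOT PRINT at 3
(typer-06 F050: Hida 1988 AIF Thm. 5.1b is `p ≥ 5`). Second candidate source (this card): the `P_(2,2)`-ordinary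
(Siegel-semi-ordinary) family `p`-adic `L`-function of the endoscopic `GU(2,2)`-packet `Π(σ_f ⊠ σ_𝛉)` over the CM Hida
family `𝛉^(𝔭)`, restricted to the `ℤ₃²`-weight space of `K` — a by-product of the host's reciprocity law, as the
«motivic p-adic L-functions» of LSZ (arXiv:2010.10946 §12, p-split case). Why it might fail: no such construction at a
supercuspidal `π_{f,3}` in print; `R₀`-integrality in the CM-period normalisation is the same atom as before.
[cite: CastellaWan2023, §2.4 Thm. 2.11 (arXiv:1607.02019)] [cite: Hida1988AIF, Thm. 5.1b] -/
theorem stub_toricExists :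
    ∀ (W : WeierstrassCurve ℚ) [W.IsElliptic] [W.IsGloballyMinimal] (N : ℕ) [NeZero N] (K : Type) [Field K]
      [NumberField K] (Dt : Literature.NumberTheory.EllipticCurves.ModularForms.ModularParametrizationData W N),
    Summit.BirchSwinnertonDyer.Rank1Residual.Additive.ClassO6 W 3 → W.HasSurjectiveModNGaloisRep 3 →
    W.analyticRank = 1 → W.conductorNorm ℤ = N → IsImaginaryQuadratic K → SatisfiesHeegnerHypothesis N K →
    ∀ (κ : ZpExtension K 3), κ.IsAnticyclotomic → ∀ (γ : Field.absoluteGaloisGroup K) [Fact (κ.IsTopGenerator γ)]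
      (𝔭 : HeightOneSpectrum (𝓞 K)), ((3 : ℕ) : 𝓞 K) ∈ 𝔭.asIdeal →
      𝔭.asIdeal.ramificationIdx (𝓞 ℚ) = 1 → 𝔭.asIdeal.inertiaDeg (𝓞 ℚ) = 1 →
    ∀ (𝔭' : HeightOneSpectrum (𝓞 K)), ((3 : ℕ) : 𝓞 K) ∈ 𝔭'.asIdeal → 𝔭' ≠ 𝔭 →
    ∀ (ι' : PadicAlgCl 3 ≃+* ℂ), Summit.BirchSwinnertonDyer.BirchSwinnertonDyer.Theorems.SchneiderFree.BranchInducesPrime 3 ι' 𝔭 →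
    ∀ (κ₁ κ₂ : ZpExtension K 3) (γ₁ γ₂ : Field.absoluteGaloisGroup K) (k : ℕ)
      [Fact (ZpExtension.IsTopGeneratorPair κ₁ κ₂ γ₁ γ₂)],
    (∀ v : HeightOneSpectrum (𝓞 K), v ≠ 𝔭 → ∀ 𝔓 ∈ v.primesAbove,
        𝔓.inertia (Field.absoluteGaloisGroup K) ≤ κ₁.kerSubgroup) →
    ZpExtension.pairKer κ₁ κ₂ ≤ κ.kerSubgroup → γ₁ * γ⁻¹ ∈ κ.kerSubgroup → γ₂ * (γ ^ (3 ^ k))⁻¹ ∈ κ.kerSubgroup →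
    ∃ (ΩK' : ℂ) (Ωp' : ℂ_[3]) (L₂ : PowerSeries (PowerSeries (unrIntegers 3))),
      ΩK' ≠ 0 ∧ Ωp' ≠ 0 ∧ IsToricTwoVarLFunction ι' 𝔭 𝔭' κ₁ κ₂ γ₁ γ₂ Dt.f ΩK' Ωp' L₂ := by
  sorry

/-- **`stub_reflectionPair`** (K4 ⊕ K3(iii); UNDECIDED, print-adjacent; = the weak-reflection half of the registered
`ThinComb.stub_combDivisibility`, binders VERBATIM): for the pinned generator image `G` and every PINNED toric `L₂` there
is a weak reflection `ρ` (fixes constants, `ρ T₂ ∉ (3, T₂)`; meant `c ∘ ι`) with `ρ G ∼ G` (Nekovář 2006 Greenberg duality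
for the `(∅, nr)` structure + transport by complex conjugation) and `ρ L₂ ∼ L₂` (two-variable functional equation of the
pinned `L₂`, unit root-number factor). Why it might fail: both inputs are untyped at `p = 3` (they would land CONDITIONAL on
two Literature facts); the `∃ρ` must serve BOTH symmetries at once (an un-pinned `∀ρ` version is false — lead g6 §3).
[cite: Nekovar2006Selmer, §10.7 (Greenberg duality)] [cite: CastellaWan2023, Thm. 2.11] -/
theorem stub_reflectionPair :
    ∀ (W : WeierstrassCurve ℚ) [W.IsElliptic] [W.IsGloballyMinimal] (N : ℕ) [NeZero N] (K : Type) [Field K]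
      [NumberField K] (Dt : Literature.NumberTheory.EllipticCurves.ModularForms.ModularParametrizationData W N),
    Summit.BirchSwinnertonDyer.Rank1Residual.Additive.ClassO6 W 3 → W.HasSurjectiveModNGaloisRep 3 →
    W.analyticRank = 1 → W.conductorNorm ℤ = N → IsImaginaryQuadratic K → SatisfiesHeegnerHypothesis N K →
    ∀ (𝔭 : HeightOneSpectrum (𝓞 K)), ((3 : ℕ) : 𝓞 K) ∈ 𝔭.asIdeal →
      𝔭.asIdeal.ramificationIdx (𝓞 ℚ) = 1 → 𝔭.asIdeal.inertiaDeg (𝓞 ℚ) = 1 →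
    ∀ (𝔭' : HeightOneSpectrum (𝓞 K)), ((3 : ℕ) : 𝓞 K) ∈ 𝔭'.asIdeal → 𝔭' ≠ 𝔭 →
    ∀ (ι' : PadicAlgCl 3 ≃+* ℂ), Summit.BirchSwinnertonDyer.BirchSwinnertonDyer.Theorems.SchneiderFree.BranchInducesPrime 3 ι' 𝔭 →
    ∀ (κ₁ κ₂ : ZpExtension K 3) (γ₁ γ₂ : Field.absoluteGaloisGroup K)
      [Fact (ZpExtension.IsTopGeneratorPair κ₁ κ₂ γ₁ γ₂)],
    (∀ v : HeightOneSpectrum (𝓞 K), v ≠ 𝔭 → ∀ 𝔓 ∈ v.primesAbove,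
        𝔓.inertia (Field.absoluteGaloisGroup K) ≤ κ₁.kerSubgroup) →
    ∀ (g : IwasawaAlgebra₂ 3),
      Literature.NumberTheory.EllipticCurves.Module.charIdeal (IwasawaAlgebra₂ 3)
        ((W.baseChange K).XGr₂ 3 κ₁ κ₂ 𝔭' γ₁ γ₂) = Ideal.span {g} →
    ∀ (ΩK : ℂ) (Ωp : ℂ_[3]) (L₂ : PowerSeries (PowerSeries (unrIntegers 3))), ΩK ≠ 0 → Ωp ≠ 0 →
      IsToricTwoVarLFunction ι' 𝔭 𝔭' κ₁ κ₂ γ₁ γ₂ Dt.f ΩK Ωp L₂ →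
    ∃ (ρ : PowerSeries (PowerSeries (unrIntegers 3)) ≃+* PowerSeries (PowerSeries (unrIntegers 3))),
      (∀ c : unrIntegers 3, ρ (const (unrIntegers 3) c) = const (unrIntegers 3) c) ∧
      ρ (T₂ (unrIntegers 3)) ∉ Ideal.span {const (unrIntegers 3) ((3 : ℕ) : unrIntegers 3), T₂ (unrIntegers 3)} ∧
      Associated (ρ (PowerSeries.map (PowerSeries.map
        (Summit.BirchSwinnertonDyer.Rank1Residual.X11b.Halves.toUnr 3)) g))
        (PowerSeries.map (PowerSeries.map (Summit.BirchSwinnertonDyer.Rank1Residual.X11b.Halves.toUnr 3)) g) ∧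
      Associated (ρ L₂) L₂ := by
  sorry

/-- **`stub_hostToothDivisibility`** (K2⁺ ALONE — THE WALL's beyond-print atom, isolated; IDEA-NEEDED = card
`wedge-square-host`): for the pinned `G` (image of a generator of `ch_{Λ₂}(X₂)`, `X₂ = X_{∅ at 𝔭, nr at 𝔭′}(E/K̃_∞)`) and
every pinned toric `L₂`, INTEGRAL thin-comb divisibility `L₂ ∈ (G, E_m(T₂))` on teeth of unbounded level. WEAKER than
the two-variable IMC divisibility `G ∣ L₂` (which gives `L₂ ∈ (G)`); expected true. SOURCE PROPOSED: per tooth `m`, the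
Siegel-semi-ordinary family class of the endoscopic `GU(2,2)`-packet `Π(σ_{f_E ⊗ ε_m} ⊠ σ_𝛉)` pushed from
`G(U(1,1) × U(1,1))` (one Siegel unit), its reciprocity law read at the UNRAMIFIED regulator prime `𝔭′` (g48: the
`Λ_U`-adic `Ĝ_a`-logarithm, `f` never stabilised) inside the `P_(2,2)`-ordinary higher-Hida family of the `U(2,2)`
fourfold, then a `Λ_U`-adic rank-0 Kolyvagin bound per tooth. Why it might fail: (i) no Euler system for the pair
`(GU(2,2), G(U(1,1)×U(1,1)))` is in print (Cauchi arXiv:1711.10571 has `H = GSp₄`, cyclotomic tower, mira-Klingen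
ordinarity); (ii) the open-orbit / level-compatibility lemma for the Siegel tower at split 3 is unchecked; (iii) the VALUE
formula at 𝛉-dominant CM points with `27 ∣ N` needs a semistable model of the host at wild level (same kernel as
K2(b-val)); (iv) slack-free integrality (RK-6 residue) is not delivered by any Kolyvagin argument in print.
[cite: Cauchi2017GU22, Thm. 1 / Prop. klingenunitary (arXiv:1711.10571 p. 3, pp. 19–21)]
[cite: LoefflerSkinnerZerbes2021GU21, Rem. 10.2.6 and Def. 12.1.4 (arXiv:2010.10946 pp. 21, 24)] -/
theorem stub_hostToothDivisibility :
    ∀ (W : WeierstrassCurve ℚ) [W.IsElliptic] [W.IsGloballyMinimal] (N : ℕ) [NeZero N] (K : Type) [Field K]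
      [NumberField K] (Dt : Literature.NumberTheory.EllipticCurves.ModularForms.ModularParametrizationData W N),
    Summit.BirchSwinnertonDyer.Rank1Residual.Additive.ClassO6 W 3 → W.HasSurjectiveModNGaloisRep 3 →
    W.analyticRank = 1 → W.conductorNorm ℤ = N → IsImaginaryQuadratic K → SatisfiesHeegnerHypothesis N K →
    ∀ (𝔭 : HeightOneSpectrum (𝓞 K)), ((3 : ℕ) : 𝓞 K) ∈ 𝔭.asIdeal →
      𝔭.asIdeal.ramificationIdx (𝓞 ℚ) = 1 → 𝔭.asIdeal.inertiaDeg (𝓞 ℚ) = 1 →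
    ∀ (𝔭' : HeightOneSpectrum (𝓞 K)), ((3 : ℕ) : 𝓞 K) ∈ 𝔭'.asIdeal → 𝔭' ≠ 𝔭 →
    ∀ (ι' : PadicAlgCl 3 ≃+* ℂ), Summit.BirchSwinnertonDyer.BirchSwinnertonDyer.Theorems.SchneiderFree.BranchInducesPrime 3 ι' 𝔭 →
    ∀ (κ₁ κ₂ : ZpExtension K 3) (γ₁ γ₂ : Field.absoluteGaloisGroup K)
      [Fact (ZpExtension.IsTopGeneratorPair κ₁ κ₂ γ₁ γ₂)],
    (∀ v : HeightOneSpectrum (𝓞 K), v ≠ 𝔭 → ∀ 𝔓 ∈ v.primesAbove,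
        𝔓.inertia (Field.absoluteGaloisGroup K) ≤ κ₁.kerSubgroup) →
    ∀ (g : IwasawaAlgebra₂ 3),
      Literature.NumberTheory.EllipticCurves.Module.charIdeal (IwasawaAlgebra₂ 3)
        ((W.baseChange K).XGr₂ 3 κ₁ κ₂ 𝔭' γ₁ γ₂) = Ideal.span {g} →
    ∀ (ΩK : ℂ) (Ωp : ℂ_[3]) (L₂ : PowerSeries (PowerSeries (unrIntegers 3))), ΩK ≠ 0 → Ωp ≠ 0 →
      IsToricTwoVarLFunction ι' 𝔭 𝔭' κ₁ κ₂ γ₁ γ₂ Dt.f ΩK Ωp L₂ →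
    ThinCombDvdInt (unrIntegers 3) 3
      (PowerSeries.map (PowerSeries.map (Summit.BirchSwinnertonDyer.Rank1Residual.X11b.Halves.toUnr 3)) g) L₂ := by
  sorry

/-- **stub_noPseudoNull** (VERBATIM the registered `ThinComb.stub_noPseudoNull`, v8.1) — WEAKER; ATTACKABLE: closed modulo
the one textbook fact `GaloisCohomology.poitouTate_shaRestricted_tateDual_natural_at` (Milne ADT I Thm. 4.10 (a)) by
`…Theorems.UniversalToricDescentThinCombNoPseudoNullOfPoitouTate.stub_noPseudoNull_of_poitouTateAt`. Under use (U2) of the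
card this stub (and the whole two-variable descent) would be unnecessary. [cite: Greenberg2016, Prop. 4.1.1] -/
theorem stub_noPseudoNull :
    ∀ (W : WeierstrassCurve ℚ) [W.IsElliptic] [W.IsGloballyMinimal] (K : Type) [Field K] [NumberField K],
    Summit.BirchSwinnertonDyer.Rank1Residual.Additive.ClassO6 W 3 → W.HasSurjectiveModNGaloisRep 3 →
    IsImaginaryQuadratic K →
    ∀ (κ : ZpExtension K 3), κ.IsAnticyclotomic → ∀ (γ : Field.absoluteGaloisGroup K) [Fact (κ.IsTopGenerator γ)]
      (𝔭 : HeightOneSpectrum (𝓞 K)), ((3 : ℕ) : 𝓞 K) ∈ 𝔭.asIdeal →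
    ∀ (𝔭' : HeightOneSpectrum (𝓞 K)), ((3 : ℕ) : 𝓞 K) ∈ 𝔭'.asIdeal → 𝔭' ≠ 𝔭 →
    ∀ (κ₁ κ₂ : ZpExtension K 3) (γ₁ γ₂ : Field.absoluteGaloisGroup K) (k : ℕ)
      [Fact (ZpExtension.IsTopGeneratorPair κ₁ κ₂ γ₁ γ₂)],
    (∀ v : HeightOneSpectrum (𝓞 K), v ≠ 𝔭 → ∀ 𝔓 ∈ v.primesAbove,
        𝔓.inertia (Field.absoluteGaloisGroup K) ≤ κ₁.kerSubgroup) →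
    ZpExtension.pairKer κ₁ κ₂ ≤ κ.kerSubgroup → γ₁ * γ⁻¹ ∈ κ.kerSubgroup → γ₂ * (γ ^ (3 ^ k))⁻¹ ∈ κ.kerSubgroup →
    Module.Finite (IwasawaAlgebra₂ 3) ((W.baseChange K).XGr₂ 3 κ₁ κ₂ 𝔭' γ₁ γ₂) →
    Module.IsTorsion (IwasawaAlgebra₂ 3) ((W.baseChange K).XGr₂ 3 κ₁ κ₂ 𝔭' γ₁ γ₂) →
    ∀ N : Submodule (IwasawaAlgebra₂ 3) ((W.baseChange K).XGr₂ 3 κ₁ κ₂ 𝔭' γ₁ γ₂),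
      Literature.NumberTheory.EllipticCurves.Module.IsPseudoNull (IwasawaAlgebra₂ 3) N → Finite N := by
  sorry

/-- **Composition** (kernel-checked, no `sorry` outside the stubs): verbatim the registered `ThinComb` composition with the
wall stub consumed in its two halves — `stub_reflectionPair` feeds `stub_weakRigidity`'s symmetry hypotheses and
`stub_hostToothDivisibility` its comb hypothesis; everything else is cited BY NAME from the landed `thin_comb` stubs. -/
theorem AdditiveSplitIMCInclusionAtThree_of :
    Summit.BirchSwinnertonDyer.BirchSwinnertonDyer.Theses.UniversalToricDescent.AdditiveSplitIMCInclusionAtThree := by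
  intro W _ _ N _ K _ _ Dt hO6 hsurj hrk hN hK hH κ hκ γ hγ 𝔭 h3 hram hdeg 𝔭' h3' hne ι' hι ΩK Ωp L hΩK hΩp hL
  obtain ⟨κ₁, κ₂, γ₁, γ₂, k, hpair, hur₁, hker, hγ₁, hγ₂⟩ :=
    Summit.BirchSwinnertonDyer.BirchSwinnertonDyer.Theorems.UniversalToricDescentThinCombLine.stub_frame K hK κ hκ γ hγ.out 𝔭 h3 𝔭' h3' hne
  haveI : Fact (ZpExtension.IsTopGeneratorPair κ₁ κ₂ γ₁ γ₂) := ⟨hpair⟩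
  obtain ⟨g, hg⟩ :=
    (Summit.BirchSwinnertonDyer.BirchSwinnertonDyer.Theorems.UniversalToricDescentThinCombLine.stub_charIdealPrincipal ((W.baseChange K).XGr₂ 3 κ₁ κ₂ 𝔭' γ₁ γ₂))
  have hg' : Literature.NumberTheory.EllipticCurves.Module.charIdeal (IwasawaAlgebra₂ 3)
      ((W.baseChange K).XGr₂ 3 κ₁ κ₂ 𝔭' γ₁ γ₂) = Ideal.span {g} := by
    simpa [Ideal.submodule_span_eq] using hg
  have hfin : Module.Finite (IwasawaAlgebra₂ 3) ((W.baseChange K).XGr₂ 3 κ₁ κ₂ 𝔭' γ₁ γ₂) :=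
    Summit.BirchSwinnertonDyer.BirchSwinnertonDyer.Theorems.SignedBaseChangeAcDivFinitePiece.xGr₂_module_finite
      (W.baseChange K) 3 κ₁ κ₂ 𝔭'
  -- K3a: a toric two-variable function at some period pair
  obtain ⟨ΩK', Ωp', L₂, hΩK', hΩp', hL₂⟩ :=
    stub_toricExists W N K Dt hO6 hsurj hrk hN hK hH κ hκ γ 𝔭 h3 hram hdeg 𝔭' h3' hne ι' hι κ₁ κ₂ γ₁ γ₂ k
      hur₁ hker hγ₁ hγ₂
  -- cross-period rigidity WITHOUT the Rankin–Selberg continuation (lead g4): `L = 0` or `(spec L₂) = (L)`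
  rcases Summit.BirchSwinnertonDyer.BirchSwinnertonDyer.Theorems.UniversalToricDescentThinComb.ContRigidity.eq_zero_or_span_spec_eq_of_toric
      K N Dt.f hK κ hκ γ hγ.out 𝔭 h3 𝔭' h3' hne ι' κ₁ κ₂ γ₁ γ₂ k hpair hγ₁ hγ₂ hΩK hΩp hL hΩK' hΩp' hL₂ with h0 | hspan
  · rw [h0, Ideal.span_singleton_eq_bot.mpr rfl]
    exact bot_le
  -- TORSION DICHOTOMY (v7): off the torsion locus of `X₂` the inclusion is vacuous
  by_cases htors : Module.IsTorsion (IwasawaAlgebra₂ 3) ((W.baseChange K).XGr₂ 3 κ₁ κ₂ 𝔭' γ₁ γ₂)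
  swap
  · have hnt := Summit.BirchSwinnertonDyer.BirchSwinnertonDyer.Theorems.UniversalToricDescentThinCombLine.stub_torsionTransfer
      W K hO6 hsurj hK κ hκ γ 𝔭 h3 𝔭' h3' hne κ₁ κ₂ γ₁ γ₂ k hur₁ hker hγ₁ hγ₂ htors
    exact Summit.BirchSwinnertonDyer.BirchSwinnertonDyer.Theorems.UniversalToricDescentCharIdealVacuity.span_le_map_charIdeal_of_not_isTorsion
      hnt _ L
  have hcong : ∃ u : (PowerSeries (PowerSeries (unrIntegers 3)))ˣ,
      L₂ - u * PowerSeries.map (PowerSeries.C (R := unrIntegers 3)) (TwoVarSubst.spec (3 ^ k) L₂) ∈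
        Ideal.span {T₂ (unrIntegers 3) - ((1 + T₁ (unrIntegers 3)) ^ (3 ^ k) - 1)} :=
    ⟨1, LineValue.sub_one_mul_map_spec_mem_lineIdeal (3 ^ k) L₂⟩
  -- K4 ⊕ K3(iii): the weak reflection pair (print-adjacent), now a stub of its own
  obtain ⟨ρ, hρc, hρT, hGsym, hLsym⟩ :=
    stub_reflectionPair W N K Dt hO6 hsurj hrk hN hK hH 𝔭 h3 hram hdeg 𝔭' h3' hne ι' hι κ₁ κ₂ γ₁ γ₂
      hur₁ g hg' ΩK' Ωp' L₂ hΩK' hΩp' hL₂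
  -- K2⁺ ALONE: integral per-tooth divisibility — the stub the wedge host is meant to source
  have hcomb :=
    stub_hostToothDivisibility W N K Dt hO6 hsurj hrk hN hK hH 𝔭 h3 hram hdeg 𝔭' h3' hne ι' hι κ₁ κ₂ γ₁ γ₂
      hur₁ g hg' ΩK' Ωp' L₂ hΩK' hΩp' hL₂
  have hdvd := Summit.BirchSwinnertonDyer.BirchSwinnertonDyer.Theorems.UniversalToricDescentThinCombLine.stub_weakRigidity ρ hρc hρT _ L₂ hGsym hLsym hcomb
  have hPN := stub_noPseudoNull W K hO6 hsurj hK κ hκ γ 𝔭 h3 𝔭' h3' hne κ₁ κ₂ γ₁ γ₂ k hur₁ hker hγ₁ hγ₂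
    hfin htors
  rw [← hspan]
  exact Summit.BirchSwinnertonDyer.BirchSwinnertonDyer.Theorems.UniversalToricDescentThinCombLine.stub_descent W K hO6 hsurj hK κ hκ γ 𝔭 h3 𝔭' h3' hne κ₁ κ₂ γ₁ γ₂ k hur₁ hker
    hγ₁ hγ₂ hfin htors hPN
    g hg' L₂ (TwoVarSubst.spec (3 ^ k) L₂) hdvd hcong

end Summit.BirchSwinnertonDyer.BirchSwinnertonDyer.Cruxes.AdditiveSplitIMCInclusionAtThree.WedgeHost

end
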